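import Mathlib
import Literature.NumberTheory.LFunctions.Zhang2022.Section17U021ChiR1SmallArgs
import Literature.NumberTheory.LFunctions.Zhang2022.Section17U021ChiR2
import HarnessLib

/-!
# Zhang (2022) §17.u021 (χ-reading), remainder `R₁` — piece M2s with its size hypotheses DISCHARGED
# (for all large `D`): `Σ_{small m₂} ≤ 8α𝓛·(e^{32}|(μχ∗1)(l₂)|(1+4𝓛)² + 63e^{128}α𝓛·τ₄(l₂)(1+4𝓛)⁴)`

Topic `Literature/NumberTheory/LFunctions/Zhang2022` (Landau–Siegel audit tree; verdict-neutral).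
Y. Zhang, *Discrete mean estimates and the Landau–Siegel zero*, arXiv:2211.02515v1 (2022)
[Zhang2022LandauSiegel] — **an unrefereed manuscript under adjudication; nothing here asserts or denies
its Theorems 1–2.** Lane ZHANG-L, WP16, sub-leaf `R1Rel` (owner zl-libB-p6 g2, CUT 2026-08-27T02:29:31Z;
helper zl-w10-p5). §17 p. 98, tex L4825.

`Typed.Section17.smallArgs_sum_le` (piece M2s, `Section17U021ChiR1SmallArgs`) carries four size
hypotheses (`δ ∈ [0,1]`, the weight facts `‖nN_β(n) − 1‖ ≤ δ` for `n ≤ D⁴`, and `|b₁|log D⁴ ≤ 1`). For all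
large `D` they hold with `δ = 21α𝓛` (zl-w16-p3's `Phi3Eval.norm_nN_sub_one_le` at the thresholds
`Phi3Eval.hE_thresholds`, `‖β₂‖,‖β₃‖ ≤ 5α`) and `|b₁|log D⁴ = 4|b₁|𝓛 ≤ 8α𝓛 ≤ 1` (`Phi3Eval.b1_size_bounds`),
and `log N ≤ 4𝓛` for `N ≤ D⁴`; so the assembler (piece A5) can consume

* `smallArgs_sum_eventually` — `ForAllLarge`: for all `l₁`, `l₂ ≥ 1`, `N` with `l₂N ≤ D⁴`,
  `Σ_{2≤m₂≤N,(m₂,l₁)=1} ‖ν₁*(l₂m₂)‖‖κ̄₂(m₂)‖(m₂/φ(m₂))²/m₂ ≤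
   8(α𝓛)·(e^{32}‖(μχ∗1)(l₂)‖(1+4𝓛)² + 63e^{128}(α𝓛)·τ₄(l₂)(1+4𝓛)⁴)` (`α𝓛 = π𝓛⁻⁸`).

Theorems only; no definitions, no named facts; axioms standard.

## References

* Y. Zhang, arXiv:2211.02515v1 (2022), §17 p. 98 (u021); §2 (2.10), (2.13); §4 (4.2).
  [cite: Zhang2022LandauSiegel, §17 u021 p.98]
-/

noncomputable section

open Complex Real ComplexConjugate Finset ArithmeticFunction

namespace Literature.NumberTheory.LFunctions.Zhang2022.Typed.Section17

open Literature.NumberTheory.LFunctions.Zhang2022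
open Literature.NumberTheory.LFunctions.Zhang2022.Skeleton
open Literature.NumberTheory.LFunctions.Zhang2022.MeanSquareMajorant
open Literature.NumberTheory.LFunctions.Zhang2022.Phi3Eval (hE_thresholds norm_nN_sub_one_le b1_size_bounds)

/-- **M2s for all large `D`** (size hypotheses of `smallArgs_sum_le` discharged: `δ = 21α𝓛`,
`|b₁|log D⁴ ≤ 8α𝓛 ≤ 1`, `log N ≤ 4𝓛`). [cite: Zhang2022LandauSiegel, §17 u021 p.98] -/
theorem smallArgs_sum_eventually (c' : ℝ) : ForAllLarge fun D _ χ =>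
    ∀ l₁ l₂ N : ℕ, 1 ≤ l₂ → l₂ * N ≤ D ^ 4 →
      ∑ m₂ ∈ (Finset.Icc 2 N).filter (fun m₂ => Nat.Coprime m₂ l₁),
          ‖nuOneStar c' χ (l₂ * m₂)‖ * ‖kappa2bar c' D m₂‖ * ((m₂ : ℝ) / Nat.totient m₂) ^ 2 / m₂ ≤
        8 * (alpha D * ell D) *
          (Real.exp 32 * ‖∑ d ∈ l₂.divisors, (ArithmeticFunction.moebius d : ℂ) * χ (d : ZMod D)‖ *
              (1 + 4 * ell D) ^ 2 +
            63 * Real.exp 128 * (alpha D * ell D) * tau 4 l₂ * (1 + 4 * ell D) ^ 4) := by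
  obtain ⟨D₀, hD₀⟩ := hE_thresholds c' 1 1 one_pos
  refine ⟨D₀, fun D _ χ hD _ _ l₁ l₂ N hl₂ hN => ?_⟩
  obtain ⟨hℓ3, hc, hT, hsmall, -⟩ := hD₀ D hD
  have hℓ1 : 1 ≤ ell D := by linarith
  have hℓ0 : 0 < ell D := by linarith
  have hα0 : 0 < alpha D := alpha_pos' hℓ0
  have hα : alpha D = Real.pi / ell D ^ 9 := by rw [alpha, bigP, Real.log_exp]
  have hαℓ : alpha D * ell D = Real.pi / ell D ^ 8 := by rw [hα]; field_simp
  have hαℓ0 : 0 ≤ alpha D * ell D := by positivity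
  -- `δ = 21α𝓛 ≤ 1`
  set δ : ℝ := 21 * (alpha D * ell D) with hδ
  have hδ0 : 0 ≤ δ := by positivity
  have hαℓsmall : alpha D * ell D ≤ 1 / 21 := by
    rw [hαℓ, div_le_div_iff₀ (by positivity) (by norm_num)]
    have h8 : (3 : ℝ) ^ 8 ≤ ell D ^ 8 := pow_le_pow_left₀ (by norm_num) hℓ3 8
    nlinarith [Real.pi_lt_four]
  have hδ1 : δ ≤ 1 := by rw [hδ]; linarith
  -- the weight facts
  have hβ2 : ‖beta2 c' D‖ ≤ 5 * alpha D :=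
    (ResidueValues.norm_beta2_le c' hℓ3 hc).trans (by linarith)
  have hβ3 : ‖beta3 c' D‖ ≤ 5 * alpha D :=
    (ResidueValues.norm_beta3_le c' hℓ3 hc).trans (by linarith)
  have hβ2re : (beta2 c' D).re = 0 := by simp [beta2]
  have hβ3re : (beta3 c' D).re = 0 := by simp [beta3]
  have hη : ∀ n : ℕ, n ≠ 0 → n ≤ D ^ 4 →
      ‖nN D (beta2 c' D) n - 1‖ ≤ δ ∧ ‖nN D (beta3 c' D) n - 1‖ ≤ δ := fun n hn hnD =>
    ⟨norm_nN_sub_one_le hℓ1 hT hsmall hβ2re hβ2 hn hnD,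
      norm_nN_sub_one_le hℓ1 hT hsmall hβ3re hβ3 hn hnD⟩
  -- `|b₁|log D⁴ = 4|b₁|𝓛 ≤ 8α𝓛 ≤ 1`
  obtain ⟨hb1, -, -⟩ := b1_size_bounds (D := D) c' hℓ3 hc
  rw [abs_neg] at hb1
  have hlogD4 : Real.log ((D : ℝ) ^ 4) = 4 * ell D := by rw [Real.log_pow, ell]; push_cast; ring
  have hθle : |b1 c' D| * Real.log ((D : ℝ) ^ 4) ≤ 8 * (alpha D * ell D) := by
    rw [hlogD4]; nlinarith [abs_nonneg (b1 c' D)]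
  have hb : |b1 c' D| * Real.log ((D : ℝ) ^ 4) ≤ 1 := hθle.trans (by linarith)
  -- `log N ≤ 4𝓛`
  have hND : N ≤ D ^ 4 := le_trans (Nat.le_mul_of_pos_left N (by omega)) hN
  have hlogN : Real.log (N : ℝ) ≤ 4 * ell D := by
    rcases Nat.eq_zero_or_pos N with hz | hz
    · rw [hz]; simp; positivity
    · calc Real.log (N : ℝ) ≤ Real.log ((D : ℝ) ^ 4) :=
            Real.log_le_log (by exact_mod_cast hz) (by exact_mod_cast hND)
        _ = 4 * ell D := hlogD4
  have hlogN0 : 0 ≤ Real.log (N : ℝ) := Real.log_natCast_nonneg N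
  -- the piece
  have h := smallArgs_sum_le c' χ hδ0 hδ1 hη hb (l₁ := l₁) hl₂ hN
  refine h.trans ?_
  have hM0 : 0 ≤ ‖∑ d ∈ l₂.divisors, (ArithmeticFunction.moebius d : ℂ) * χ (d : ZMod D)‖ := norm_nonneg _
  have hτ0 : 0 ≤ tau 4 l₂ := tau_nonneg _ _
  have hpow2 : (1 + Real.log (N : ℝ)) ^ 2 ≤ (1 + 4 * ell D) ^ 2 :=
    pow_le_pow_left₀ (by linarith) (by linarith) 2
  have hpow4 : (1 + Real.log (N : ℝ)) ^ 4 ≤ (1 + 4 * ell D) ^ 4 :=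
    pow_le_pow_left₀ (by linarith) (by linarith) 4
  have hθ0 : 0 ≤ |b1 c' D| * Real.log ((D : ℝ) ^ 4) := by rw [hlogD4]; positivity
  calc |b1 c' D| * Real.log ((D : ℝ) ^ 4) *
        (Real.exp 32 * ‖∑ d ∈ l₂.divisors, (ArithmeticFunction.moebius d : ℂ) * χ (d : ZMod D)‖ *
            (1 + Real.log N) ^ 2 +
          3 * Real.exp 128 * δ * tau 4 l₂ * (1 + Real.log N) ^ 4)
      ≤ 8 * (alpha D * ell D) *
        (Real.exp 32 * ‖∑ d ∈ l₂.divisors, (ArithmeticFunction.moebius d : ℂ) * χ (d : ZMod D)‖ *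
            (1 + 4 * ell D) ^ 2 +
          3 * Real.exp 128 * δ * tau 4 l₂ * (1 + 4 * ell D) ^ 4) := by
        gcongr
    _ = _ := by rw [hδ]; ring

end Literature.NumberTheory.LFunctions.Zhang2022.Typed.Section17
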